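import Summits.AtomisticToContinuum.HydrodynamicLimit.Theses.DimensionLadder

/-!
# Line `EntropyChaosLine` — birth skeleton for the crux `PairFactorisationAllDim` (stmt-AtomisticToContinuum-18871)

Route `route-AtomisticToContinuum-DimensionLadder`; the crux is ENGINE HALF 2 of the glued split of the deciding crux
`AllDimensionEuler` (stmt-9342) — ASYMPTOTIC PAIR FACTORISATION: for every `d ≥ 3`, under the packing-guarded hypotheses
of the target, the two-particle marginal of the time-`t` density `W_N(t) = 1_D · (canonical local-Gibbs density ∘ Φ_N(−t))`
minus the product of its one-particle marginals tends to `0` in `(1+|v|²)(1+|v′|²)`-weighted `L¹`.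
Strategist `planner-cstrat-stmt-AtomisticToContinuum-9342-r1-0`, 2026-08-17 (BC3 skeleton for the new piece).

## The line: RELATIVE ENTROPY (Yau / Olla–Varadhan–Yau) + ENTROPIC CHAOS TRANSFER (Kosygina; Ben Arous–Zeitouni) + TAILS

Chaos is inherited from the reference: a law at specific relative entropy `o(1)` from a DILUTE local Gibbs state — whose
own pair correlations live on the excluded volume `≍ ε^d → 0` and on the canonical `O(1/N)` constraint — is itself
asymptotically pair-factorised. The conclusion of the crux is reached from five registered stubs through the
kernel-checked composition `PairFactorisationAllDim_of`:

1. `stub_localGibbsEntropy : LocalGibbsEntropy` (XL, open — THE HARDEST STUB; the SAME statement as stub 1 of the sibling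
   skeleton `Cruxes/OneBodyMaxwellianAllDim` `EntropyLine`: one dynamical estimate serves both engine halves). Yau's
   relative-entropy estimate for deterministic hard spheres at fixed reduced density, parametrised by the packing level
   `η ≤ η₁(d)`: for every `t < T` an activity `b_t` (continuous, positive, unit mass, `b_t σ^d < 2η`) with the canonical
   local Gibbs state `R_N[b_t,u_t,θ_t]` reproducing `ρ_t M_{u_t,θ_t}` at the one-body level and
   `H(W_N(t) | R_N[b_t,u_t,θ_t])/(N+1) → 0`.
2. `stub_entropyToChaos : EntropyToChaos` (L; GENERAL exchangeable densities `F_N`, no dynamics): in the dilute regime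
   `∫ b = 1`, `b σ^d < η₁(d)`, vanishing specific relative entropy w.r.t. `R_N[b,u',θ']` plus uniform integrability of the
   quartic velocity weight under `F¹_N` give `F²_N − F¹_N ⊗ F¹_N → 0` in `(1+|v|²)(1+|v′|²)`-weighted `L¹`. (Two-body
   Kosygina-type transfer `‖F²_N − R²_N‖₁, ‖F¹_N − R¹_N‖₁ → 0` by block superadditivity of relative entropy + exponential
   mixing of the dilute reference; pair factorisation OF THE REFERENCE by cluster expansion — excluded volume `≍ ε_N^d`,
   truncated pair correlation of range `≍ ε_N`, canonical `O(1/N)`; weights by Cauchy–Schwarz from the one-body tail.)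
3. `stub_velocityTails : VelocityTails` (M/L; same statement as in the sibling skeleton): uniform integrability of
   `(1+|v|²)²` under `F¹_N(t)` — by exchangeability and Cauchy–Schwarz exactly what controls the `(1+|v|²)(1+|v′|²)` tails
   of `F²_N(t)` and of `F¹_N ⊗ F¹_N`.
4. `stub_timeDensityLaw : TimeDensityLaw` (M, provable now): measurability, positivity, unit mass of `W_N(t)` for `σ < 1/2`.
5. `stub_flowRelabelSymmetry : FlowRelabelSymmetry` (M, provable now; = route support item stmt-9346 BY NAME).

Composition (`PairFactorisationAllDim_of`, ≈ 35 tactic lines, sorry-free): thresholds `η₀ := min (min η_e η_t) (η₁/2)`,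
`σ₀ := min (min σ_e σ_t) (1/2)`; stub 1 at level `η₀` gives `b σ^d < 2η₀ ≤ η₁` for stub 2; stubs 3–5 supply tails,
bookkeeping and exchangeability; stub 2 is applied to `F_N := W_N(t)`.

## Why no stub is the crux, the engine, or the summit (probes in `bc2/`, all must FAIL)

* `LocalGibbsEntropy`: `N`-body entropy, no marginal statement; incomparable with the crux and with `HydrodynamicLimit`.
* `EntropyToChaos`, `TimeDensityLaw`, `FlowRelabelSymmetry`: no dynamics-to-Euler content.
* `VelocityTails`: a one-body moment bound; identifies nothing, decorrelates nothing.

Barriers: `MacroErgodicityBarrier` bites stub 1 (deterministic local ergodicity; OVY need noise) — the route's bet is the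
top rung's fresh grazing kicks; `BoltzmannHypothesisBarrier` (Lanford-window chaos propagation) is NOT the mechanism here:
chaos is inherited from entropy-closeness to a chaotic reference, not propagated collision by collision;
`HighMomentumCutoffBarrier` is confined to stub 3. Disproof used: none exists for this crux. Dead lines: none registered.

[cite: OllaVaradhanYau1993, Thm. 1.1, §3] [cite: Sznitman1991, Prop. 2.2] [cite: Spohn1991, Part I §3.2 (3.22)]
-/

noncomputable section

namespace Summit.AtomisticToContinuum.HydrodynamicLimit.Cruxes.PairFactorisationAllDim.EntropyChaosLine

open scoped BigOperators Topology Classical MeasureTheory InnerProductSpace ENNReal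
open Filter Set Function TopologicalSpace MeasureTheory InformationTheory
open Literature.MathematicalPhysics.KineticTheory Literature.Analysis.FluidPDE Literature.Analysis.FunctionSpaces
open Summit.AtomisticToContinuum.HydrodynamicLimit.Theses.DimensionLadder (PairFactorisationAllDim FlowRelabelSymmetry)

/-! ## Vocabulary (transparent abbreviations over Literature declarations) -/

/-- One-particle phase space `𝕋^d × ℝ^d`. -/
abbrev Pt (d : ℕ) : Type := UnitAddTorus (Fin d) × EuclideanSpace ℝ (Fin d)

/-- `(N+1)`-particle phase space. -/
abbrev Cfg (d N : ℕ) : Type := Config (N + 1) (Fin d) (UnitAddTorus (Fin d))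

/-- The time-`t` `(N+1)`-body density `W_N(t) = 1_D · (canonical local-Gibbs density ∘ Φ_N(−t))` of the crux. -/
abbrev timeDensity (d : ℕ) (σ : ℝ) (a₀ : UnitAddTorus (Fin d) → ℝ)
    (u₀ : UnitAddTorus (Fin d) → EuclideanSpace ℝ (Fin d)) (θ₀ : UnitAddTorus (Fin d) → ℝ) (N : ℕ)
    (Φ : HardSphereFlow (Torus.geometry (Fin d)) (hsDiameterDim d σ N) (N + 1)) (t : ℝ) : Cfg d N → ℝ :=
  (hardSphereDomain (Torus.geometry (Fin d)) (N + 1) (hsDiameterDim d σ N)).indicator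
    (hsTransport Φ t (canonicalDensity (Torus.geometry (Fin d)) (hsDiameterDim d σ N) (N + 1)
      (localGibbsProfileDim d a₀ u₀ θ₀)))

/-- The REFERENCE: canonical local Gibbs density of `N+1` hard spheres with activity `b`, velocity field `u'`,
temperature field `θ'` (same diameter `hsDiameterDim d σ N`). -/
abbrev refDensity (d : ℕ) (σ : ℝ) (b : UnitAddTorus (Fin d) → ℝ)
    (u' : UnitAddTorus (Fin d) → EuclideanSpace ℝ (Fin d)) (θ' : UnitAddTorus (Fin d) → ℝ) (N : ℕ) : Cfg d N → ℝ :=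
  canonicalDensity (Torus.geometry (Fin d)) (hsDiameterDim d σ N) (N + 1) (localGibbsProfileDim d b u' θ')

/-- The law `F dz` of a real density on `(N+1)`-particle phase space (negative part cut off). -/
abbrev lawOf {d N : ℕ} (F : Cfg d N → ℝ) : Measure (Cfg d N) :=
  (volume : Measure (Cfg d N)).withDensity fun z => ENNReal.ofReal (F z)

/-- SPECIFIC RELATIVE ENTROPY `H(F | R) / (N+1)` (Mathlib `klDiv`, `ℝ≥0∞`-valued: it is `∞` unless `F dz ≪ R dz` with
integrable log-likelihood ratio — no junk value can make a `Tendsto … (nhds 0)` clause vacuously true). -/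
abbrev specRelEnt {d N : ℕ} (F R : Cfg d N → ℝ) : ℝ≥0∞ :=
  klDiv (lawOf F) (lawOf R) / ((N : ℝ≥0∞) + 1)

/-- The one-particle marginal as a function on `Pt d` (the crux's `nthMarginal (N+1) 1 W (fun _ => y)`). -/
abbrev oneMarginal {d N : ℕ} (F : Cfg d N → ℝ) (y : Pt d) : ℝ :=
  nthMarginal (N + 1) 1 F (fun _ => y)

/-- `(1+|v|²)²`-weighted `L¹` distance of one-body functions (the crux's norm). -/
abbrev wDist (d : ℕ) (f g : Pt d → ℝ) : ℝ≥0∞ :=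
  ∫⁻ y, ENNReal.ofReal ((1 + ‖y.2‖ ^ 2) ^ 2 * |f y - g y|)

/-- `(1+|v|²)²`-weighted velocity TAIL of a one-body function beyond speed `R`. -/
abbrev wTail (d : ℕ) (R : ℝ) (f : Pt d → ℝ) : ℝ≥0∞ :=
  ∫⁻ y in {y : Pt d | R < ‖y.2‖}, ENNReal.ofReal ((1 + ‖y.2‖ ^ 2) ^ 2 * f y)

/-! ## Stub statements -/

/-- STUB 1 statement — YAU'S RELATIVE-ENTROPY ESTIMATE for deterministic hard spheres at fixed reduced density, every
`d ≥ 3`, parametrised by the packing level `η ≤ η₁(d)`: along a guarded classical hard-sphere Euler solution, for every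
`t < T` there is an activity profile `b` (continuous, positive, unit mass, `b σ^d < 2η`) whose canonical local Gibbs
state with the Euler velocity/temperature fields `(u_t, θ_t)` (i) has one-marginal converging in `(1+|v|²)²`-weighted
`L¹` to `ρ_t M_{1,u_t,θ_t}` and (ii) is at specific relative entropy `o(1)` from the true time-`t` law. -/
def LocalGibbsEntropy : Prop :=
  ∀ d : ℕ, 3 ≤ d → ∃ η₁ : ℝ, 0 < η₁ ∧ ∀ η : ℝ, 0 < η → η ≤ η₁ →
    ∀ (a₀ θ₀ : UnitAddTorus (Fin d) → ℝ) (u₀ : UnitAddTorus (Fin d) → EuclideanSpace ℝ (Fin d)),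
      Continuous a₀ → Continuous θ₀ → Continuous u₀ → (∀ x, 0 < a₀ x) → (∀ x, 0 < θ₀ x) →
    ∃ σ₀ : ℝ, 0 < σ₀ ∧ ∀ σ : ℝ, 0 < σ → σ < σ₀ →
    ∀ (T : ℝ) (ρ θ : ℝ → UnitAddTorus (Fin d) → ℝ) (u : ℝ → UnitAddTorus (Fin d) → EuclideanSpace ℝ (Fin d)),
      IsHardSphereEulerSolutionDim d σ T ρ u θ → (∀ t ∈ Set.Ico 0 T, ∀ x, ρ t x * σ ^ d < η) →
    ∀ Φ : (N : ℕ) → HardSphereFlow (Torus.geometry (Fin d)) (hsDiameterDim d σ N) (N + 1),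
      TendstoHydroFieldsAtDim d (fun N => localGibbsLawDim d σ a₀ u₀ θ₀ N (Φ N)) Φ ρ u θ 0 →
    ∀ t ∈ Set.Ico 0 T, ∃ b : UnitAddTorus (Fin d) → ℝ,
      Continuous b ∧ (∀ x, 0 < b x) ∧ (∫ x, b x = 1) ∧ (∀ x, b x * σ ^ d < 2 * η) ∧
      Tendsto (fun N : ℕ => wDist d (oneMarginal (refDensity d σ b (u t) (θ t) N))
        (localGibbsProfileDim d (ρ t) (u t) (θ t))) atTop (nhds 0) ∧
      Tendsto (fun N : ℕ => specRelEnt (timeDensity d σ a₀ u₀ θ₀ N (Φ N) t) (refDensity d σ b (u t) (θ t) N))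
        atTop (nhds 0)

/-- STUB 2 statement — ENTROPY ⇒ CHAOS (entropic-chaos transfer, general exchangeable densities, no dynamics): in the
dilute regime `b σ^d < η₁(d)` of the canonical hard-sphere local Gibbs reference, vanishing specific relative entropy plus
uniform integrability of the quartic velocity weight under `F¹_N` force asymptotic pair factorisation of `F_N` in
`(1+|v|²)(1+|v′|²)`-weighted `L¹` (the crux's norm and term, verbatim). -/
def EntropyToChaos : Prop :=
  ∀ d : ℕ, 3 ≤ d → ∃ η₁ : ℝ, 0 < η₁ ∧
    ∀ (σ : ℝ) (b θ' : UnitAddTorus (Fin d) → ℝ) (u' : UnitAddTorus (Fin d) → EuclideanSpace ℝ (Fin d)),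
      0 < σ → Continuous b → Continuous θ' → Continuous u' → (∀ x, 0 < b x) → (∀ x, 0 < θ' x) →
      (∫ x, b x = 1) → (∀ x, b x * σ ^ d < η₁) →
    ∀ F : (N : ℕ) → Cfg d N → ℝ,
      (∀ N, Measurable (F N)) → (∀ N z, 0 ≤ F N z) → (∀ N, ∫ z, F N z = 1) →
      (∀ (N : ℕ) (π : Equiv.Perm (Fin (N + 1))), (fun z : Cfg d N => F N (z ∘ π)) =ᵐ[volume] F N) →
      Tendsto (fun N : ℕ => specRelEnt (F N) (refDensity d σ b u' θ' N)) atTop (nhds 0) →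
      (∀ κ : ℝ, 0 < κ → ∃ R : ℝ, ∀ᶠ N : ℕ in atTop, wTail d R (oneMarginal (F N)) ≤ ENNReal.ofReal κ) →
      Tendsto (fun N : ℕ => ∫⁻ p : Pt d × Pt d, ENNReal.ofReal ((1 + ‖p.1.2‖ ^ 2) * (1 + ‖p.2.2‖ ^ 2) *
        |nthMarginal (N + 1) 2 (F N) ![p.1, p.2] - nthMarginal (N + 1) 1 (F N) ![p.1] * nthMarginal (N + 1) 1 (F N) ![p.2]|))
        atTop (nhds 0)

/-- STUB 3 statement — VELOCITY TAILS: under the crux's guarded hypotheses, for every `t < T` the `(1+|v|²)²`-weighted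
tail of the one-particle marginal of the time-`t` law beyond speed `R` is, eventually in `N`, smaller than any `κ > 0`
once `R` is large (uniform integrability of the quartic velocity weight). -/
def VelocityTails : Prop :=
  ∀ d : ℕ, 3 ≤ d → ∃ η₀ : ℝ, 0 < η₀ ∧
    ∀ (a₀ θ₀ : UnitAddTorus (Fin d) → ℝ) (u₀ : UnitAddTorus (Fin d) → EuclideanSpace ℝ (Fin d)),
      Continuous a₀ → Continuous θ₀ → Continuous u₀ → (∀ x, 0 < a₀ x) → (∀ x, 0 < θ₀ x) →
    ∃ σ₀ : ℝ, 0 < σ₀ ∧ ∀ σ : ℝ, 0 < σ → σ < σ₀ →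
    ∀ (T : ℝ) (ρ θ : ℝ → UnitAddTorus (Fin d) → ℝ) (u : ℝ → UnitAddTorus (Fin d) → EuclideanSpace ℝ (Fin d)),
      IsHardSphereEulerSolutionDim d σ T ρ u θ → (∀ t ∈ Set.Ico 0 T, ∀ x, ρ t x * σ ^ d < η₀) →
    ∀ Φ : (N : ℕ) → HardSphereFlow (Torus.geometry (Fin d)) (hsDiameterDim d σ N) (N + 1),
      TendstoHydroFieldsAtDim d (fun N => localGibbsLawDim d σ a₀ u₀ θ₀ N (Φ N)) Φ ρ u θ 0 →
    ∀ t ∈ Set.Ico 0 T, ∀ κ : ℝ, 0 < κ → ∃ R : ℝ, ∀ᶠ N : ℕ in atTop,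
      wTail d R (oneMarginal (timeDensity d σ a₀ u₀ θ₀ N (Φ N) t)) ≤ ENNReal.ofReal κ

/-- STUB 4 statement — DENSITY-LAW BOOKKEEPING (provable now): for `0 < σ < 1/2` (so that `N+1` spheres of diameter
`σ(N+1)^{-1/d}` fit on the unit torus and the canonical partition function is positive) the time-`t` density is
measurable, nonnegative and of total mass one (`HardSphereFlow.measurable_flow`, `.measurePreserving`). -/
def TimeDensityLaw : Prop :=
  ∀ d : ℕ, 3 ≤ d → ∀ (σ : ℝ) (a₀ θ₀ : UnitAddTorus (Fin d) → ℝ) (u₀ : UnitAddTorus (Fin d) → EuclideanSpace ℝ (Fin d)),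
    0 < σ → σ < 1 / 2 → Continuous a₀ → Continuous θ₀ → Continuous u₀ → (∀ x, 0 < a₀ x) → (∀ x, 0 < θ₀ x) →
    ∀ (N : ℕ) (Φ : HardSphereFlow (Torus.geometry (Fin d)) (hsDiameterDim d σ N) (N + 1)) (t : ℝ),
      Measurable (timeDensity d σ a₀ u₀ θ₀ N Φ t) ∧ (∀ z, 0 ≤ timeDensity d σ a₀ u₀ θ₀ N Φ t z) ∧
        ∫ z, timeDensity d σ a₀ u₀ θ₀ N Φ t z = 1

/-! ## The registered stubs -/

/-- STUB 1 (XL, open) — Yau's relative-entropy estimate, deterministic hard spheres, every `d ≥ 3`. -/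
theorem stub_localGibbsEntropy : LocalGibbsEntropy := by
  sorry

/-- STUB 2 (L) — specific relative entropy `o(1)` w.r.t. a dilute local Gibbs reference ⇒ asymptotic pair factorisation. -/
theorem stub_entropyToChaos : EntropyToChaos := by
  sorry

/-- STUB 3 (M/L) — uniform integrability of the quartic velocity weight under the one-particle marginal at time `t`. -/
theorem stub_velocityTails : VelocityTails := by
  sorry

/-- STUB 4 (M, provable now) — measurability, positivity and unit mass of the time-`t` density for `σ < 1/2`. -/
theorem stub_timeDensityLaw : TimeDensityLaw := by
  sorry

/-- STUB 5 (M, provable now; = route support item stmt-AtomisticToContinuum-9346 BY NAME) — exchangeability. -/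
theorem stub_flowRelabelSymmetry : FlowRelabelSymmetry := by
  sorry

/-! ## The composition -/

/-- **THE COMPOSITION** — the crux `DimensionLadder.PairFactorisationAllDim` BY NAME from the five registered stubs. -/
theorem PairFactorisationAllDim_of : PairFactorisationAllDim := by
  intro d hd
  obtain ⟨η₁, hη₁, K⟩ := (stub_entropyToChaos : EntropyToChaos) d hd
  obtain ⟨ηe, hηe, E⟩ := (stub_localGibbsEntropy : LocalGibbsEntropy) d hd
  obtain ⟨ηt, hηt, Tl⟩ := (stub_velocityTails : VelocityTails) d hd
  have hη₀pos : 0 < min (min ηe ηt) (η₁ / 2) := lt_min (lt_min hηe hηt) (half_pos hη₁)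
  have hη₀e : min (min ηe ηt) (η₁ / 2) ≤ ηe := le_trans (min_le_left _ _) (min_le_left _ _)
  have hη₀t : min (min ηe ηt) (η₁ / 2) ≤ ηt := le_trans (min_le_left _ _) (min_le_right _ _)
  have hη₀1 : 2 * min (min ηe ηt) (η₁ / 2) ≤ η₁ := by
    have h := min_le_right (min ηe ηt) (η₁ / 2)
    linarith
  refine ⟨min (min ηe ηt) (η₁ / 2), hη₀pos, ?_⟩
  intro a₀ θ₀ u₀ ha hθ hu ha0 hθ0
  obtain ⟨σe, hσe, E'⟩ := E (min (min ηe ηt) (η₁ / 2)) hη₀pos hη₀e a₀ θ₀ u₀ ha hθ hu ha0 hθ0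
  obtain ⟨σt, hσt, T'⟩ := Tl a₀ θ₀ u₀ ha hθ hu ha0 hθ0
  refine ⟨min (min σe σt) (1 / 2), lt_min (lt_min hσe hσt) one_half_pos, ?_⟩
  intro σ hσ hσlt T ρ θ u hsol hguard Φ h0 t ht
  have hσe' : σ < σe := lt_of_lt_of_le hσlt (le_trans (min_le_left _ _) (min_le_left _ _))
  have hσt' : σ < σt := lt_of_lt_of_le hσlt (le_trans (min_le_left _ _) (min_le_right _ _))
  have hσh : σ < 1 / 2 := lt_of_lt_of_le hσlt (min_le_right _ _)
  have hguard_t : ∀ s ∈ Set.Ico 0 T, ∀ x, ρ s x * σ ^ d < ηt :=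
    fun s hs x => lt_of_lt_of_le (hguard s hs x) hη₀t
  obtain ⟨b, hbc, hbpos, hb1, hbg, _hcons, hent⟩ := E' σ hσ hσe' T ρ θ u hsol hguard Φ h0 t ht
  have htail := T' σ hσ hσt' T ρ θ u hsol hguard_t Φ h0 t ht
  have hθc : Continuous (θ t) := (hsol.smooth_temperature.isSmooth_slice ht).continuous
  have huc : Continuous (u t) := (hsol.smooth_velocity.isSmooth_slice ht).continuous
  have hθpos : ∀ x, 0 < θ t x := hsol.temperature_pos t ht
  have hbg' : ∀ x, b x * σ ^ d < η₁ := fun x => lt_of_lt_of_le (hbg x) hη₀1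
  have hlaw := fun N : ℕ =>
    (stub_timeDensityLaw : TimeDensityLaw) d hd σ a₀ θ₀ u₀ hσ hσh ha hθ hu ha0 hθ0 N (Φ N) t
  have hsymm : ∀ (N : ℕ) (π : Equiv.Perm (Fin (N + 1))),
      (fun z : Cfg d N => timeDensity d σ a₀ u₀ θ₀ N (Φ N) t (z ∘ π)) =ᵐ[volume]
        timeDensity d σ a₀ u₀ θ₀ N (Φ N) t :=
    fun N π => (stub_flowRelabelSymmetry : FlowRelabelSymmetry) d hd σ a₀ θ₀ u₀ Φ t N π hσ
  exact K σ b (θ t) (u t) hσ hbc hθc huc hbpos hθpos hb1 hbg' (fun N => timeDensity d σ a₀ u₀ θ₀ N (Φ N) t)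
    (fun N => (hlaw N).1) (fun N => (hlaw N).2.1) (fun N => (hlaw N).2.2) hsymm hent htail

end Summit.AtomisticToContinuum.HydrodynamicLimit.Cruxes.PairFactorisationAllDim.EntropyChaosLine

end
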